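import Literature.Computability.AlgebraicComplexity.FSV18SparseHittingProofs

/-!
# FSV Thm. 9 (ToC Thm. 1.10): the occur-`k` bullet from Cor. 49, and the ASSEMBLY of the summary
# theorem from the section facts

Forbes–Shpilka–Volk 2018, Thm. 9 = the conjunction `FSV2018_thm9` of its seven bullets (typed by
val-lit t18 in `FSV18SuccinctGenerators.lean`; the LOAD-BEARING declaration of the cell's GAP row N1).
Each bullet is the paper's summary of one section; the file of record already derives five bullets
from the section statements (`FSV2018_thm9_spsk_of_cor22`, `…_trdeg_of_thm24`, `…_smesp_of_thm37`,
`…_commROABP_of_cor44`, and — unconditionally, val-lit t19 — `FSV2018_thm9_sparse_holds`). This file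
adds

* `FSV2018_thm9_occur_of_cor49` — bullet "depth-`D` occur-`k` formulas" (§5.4) from Cor. 49 (the
  hitting property of `G^{ASSS}`, [ASSS16]) and the PROVED succinctness of Construction 46
  (`isSuccinctGenerator_asssGenCoeff`, Fact 47): top fan-in `(D-2)R + R⌈log₂ s⌉ + R⌈log₂ R⌉ + 1`,
  `R = (2k)^{2D·2^D}`, is `poly(log s, n)` for `k, D = O(1)` — uniform exponent
  `c = (D-2)R + R + R⌈log₂ R⌉ + 3`;
* `FSV2018_thm9_of_facts` — **Thm. 9 as an explicit conditional on exactly the external inputs of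
  §§4–5**: Fact 19 ([SS12]-type rank condenser hitting), Lemma 23 ([BMS13] Jacobian hitting set),
  Lemma 36 ([Forbes15] shifted sparsity of `Σm∧ΣΠ`), Thm. 43 (commutative roABPs, via [FSS14]),
  Cor. 49 ([ASSS16] occur-`k`), and the §6 bullet `FSV2018_thm9_sparseTrdeg` (whose reduction to
  Lemma 53 lives with the §6–8 file `FSV2018ROABP.lean`); the sparse bullet needs nothing.

WHAT THIS IS NOT: no new named fact is introduced and none of the listed inputs is proved here;
nothing bears on FSV Question 6 / the crux `SuccinctHittingSetsForVP` (regime `d = n`, ALL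
`poly(N)`-size distinguishers), which stays open.

References: [ForbesShpilkaVolk2018] Thm. 9 (seq.) = ToC Thm. 1.10; Construction 46, Fact 47,
Thm. 48, Cor. 49 (seq.) = ToC 5.22–5.25; Cor. 22, Thm. 24, Thm. 37, Cor. 44.
-/

noncomputable section

namespace Literature.Computability.AlgebraicComplexity

open MvPolynomial

namespace FSV2018Thm9Assembly

/-- Absorbing a constant: `A · L² ≤ L^(A+2)` for `L ≥ 2` (since `A ≤ 2^A ≤ L^A`). [folklore] -/
private theorem mul_sq_le_pow {A L : ℕ} (hL : 2 ≤ L) : A * L ^ 2 ≤ L ^ (A + 2) := by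
  have hA : A ≤ 2 ^ A := Nat.lt_two_pow_self.le
  calc A * L ^ 2 ≤ 2 ^ A * L ^ 2 := Nat.mul_le_mul_right _ hA
    _ ≤ L ^ A * L ^ 2 := Nat.mul_le_mul_right _ (Nat.pow_le_pow_left hL A)
    _ = L ^ (A + 2) := by rw [← pow_add]

end FSV2018Thm9Assembly

open FSV2018Thm9Assembly

/-- **Thm. 9, occur-`k` bullet with EXPLICIT exponent, PROVED modulo Cor. 49** (the hitting
property of `G^{ASSS}`, [ASSS16]): with the PROVED succinctness of Construction 46
(`isSuccinctGenerator_asssGenCoeff`, Fact 47) the outputs are read-once affine product sums of top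
fan-in `K = (D-2)R + (R⌈log₂ s⌉ + R⌈log₂ R⌉ + 1)`, `R = (2k)^{2D·2^D}`, and `K (n+2) ≤ (⌈log₂ s⌉ + n + 2)^c`
for the uniform exponent `c = (D-2)R + R + R⌈log₂ R⌉ + 3`. Stated with the Cor. 49 characteristic
clause and the explicit exponent so that `FSV2018_thm9_occur` can be packed from it in either of
its shapes (val-lit lead-np RULING (33): the named fact's `R` becomes existential in its safe
reading). [cite: ForbesShpilkaVolk2018, Thm. 9 and Cor. 49 (seq.) = ToC Thm. 1.10 and Cor. 5.25, pp. 15, 30] -/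
theorem multilinearSPSHits_occurClass_of_cor49 (h : FSV2018_cor49) (D k : ℕ) :
    ∀ (F : Type) [Field F] [Infinite F] (n s : ℕ),
      (ringChar F = 0 ∨ s ^ asssR k D < ringChar F) →
        MultilinearSPSHits F n
          ((Nat.clog 2 s + n + 2) ^ ((D - 2) * asssR k D + asssR k D + asssR k D * Nat.clog 2 (asssR k D) + 1 + 2))
          (occurClass F (multilinearMonomials n) D k s) := by
  intro F _ _ n s hchar
  set R := asssR k D with hR
  refine multilinearSPSHits_of_generator (h F n D k s hchar)
    (isSuccinctGenerator_asssGenCoeff (F := F) (n := n) D k s) ?_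
  set L := Nat.clog 2 s + n + 2 with hL
  have hL2 : 2 ≤ L := by omega
  have hL1 : 1 ≤ L := by omega
  have hls : Nat.clog 2 s ≤ L := by omega
  -- the top fan-in is at most `A · L` with `A = (D-2)R + R + R⌈log₂ R⌉ + 1`
  have h1 : (D - 2) * R ≤ (D - 2) * R * L := Nat.le_mul_of_pos_right _ (by omega)
  have h2 : R * Nat.clog 2 s ≤ R * L := Nat.mul_le_mul_left R hls
  have h3 : R * Nat.clog 2 R ≤ R * Nat.clog 2 R * L := Nat.le_mul_of_pos_right _ (by omega)
  have h4 : 1 ≤ 1 * L := by omega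
  have hK : (D - 2) * asssR k D + (asssK k D s + 1) ≤
      ((D - 2) * R + R + R * Nat.clog 2 R + 1) * L := by
    rw [asssK, ← hR]
    calc (D - 2) * R + (R * Nat.clog 2 s + R * Nat.clog 2 R + 1)
        ≤ (D - 2) * R * L + (R * L + R * Nat.clog 2 R * L + 1 * L) :=
          Nat.add_le_add h1 (Nat.add_le_add (Nat.add_le_add h2 h3) h4)
      _ = ((D - 2) * R + R + R * Nat.clog 2 R + 1) * L := by ring
  calc ((D - 2) * asssR k D + (asssK k D s + 1)) * (n + 2)
      ≤ (((D - 2) * R + R + R * Nat.clog 2 R + 1) * L) * L :=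
        Nat.mul_le_mul hK (by omega)
    _ = ((D - 2) * R + R + R * Nat.clog 2 R + 1) * L ^ 2 := by ring
    _ ≤ L ^ ((D - 2) * R + R + R * Nat.clog 2 R + 1 + 2) := mul_sq_le_pow hL2

set_option linter.unusedTactic false in
set_option linter.unreachableTactic false in
/-- **Thm. 9, occur-`k` bullet, PROVED modulo Cor. 49** — the named fact `FSV2018_thm9_occur` packed
SHAPE-AGNOSTICALLY from `multilinearSPSHits_occurClass_of_cor49` (val-lit lead-np RULING (33): the
term builds both for the verbatim shape `∃ c, …` with `asssR k D` in the characteristic clause and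
for the safe reading `∃ c R, …`; the dead branch is dropped at a later edit).
[cite: ForbesShpilkaVolk2018, Thm. 9 and Cor. 49 (seq.) = ToC Thm. 1.10 and Cor. 5.25, pp. 15, 30] -/
theorem FSV2018_thm9_occur_of_cor49 (h : FSV2018_cor49) : FSV2018_thm9_occur := by
  intro D k
  first
    | exact ⟨_, multilinearSPSHits_occurClass_of_cor49 h D k⟩
    | exact ⟨_, asssR k D, multilinearSPSHits_occurClass_of_cor49 h D k⟩

/-- **FSV Thm. 9 (ToC Thm. 1.10) ASSEMBLED from the section statements**: the summary theorem
(the conjunction `FSV2018_thm9` of its seven bullets) follows from the external inputs of §§4–5 —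
Fact 19 (rank-condenser hitting, `Σ^{O(1)}ΠΣ`), Lemma 23 ([BMS13], transcendence degree), Lemma 36
([Forbes15], `Σm∧ΣΠ^{O(1)}`), Thm. 43 (commutative roABPs), Cor. 49 ([ASSS16], occur-`k`) — together
with the §6 bullet (`FSV2018_thm9_sparseTrdeg`, reduced to Lemma 53 in `FSV2018ROABP.lean`); the
sparse bullet is unconditional (`FSV2018_thm9_sparse_holds`). Each arrow is the paper's own one-line
derivation (Cor. 22, Thm. 24, Thm. 37, Cor. 44, Cor. 49 ⇒ bullets).
[cite: ForbesShpilkaVolk2018, Thm. 9 (seq.) = ToC Thm. 1.10, pp. 14–15] -/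
theorem FSV2018_thm9_of_facts (h19 : FSV2018_fact19) (h23 : FSV2018_lemma23)
    (h36 : FSV2018_lemma36) (h43 : FSV2018_thm43) (h49 : FSV2018_cor49)
    (h6 : FSV2018_thm9_sparseTrdeg) : FSV2018_thm9 :=
  ⟨FSV2018_thm9_spsk_of_cor22 (FSV2018_cor22_of_fact19 h19),
    FSV2018_thm9_trdeg_of_thm24 (FSV2018_thm24_of_lemma23 h23),
    FSV2018_thm9_sparse_holds,
    FSV2018_thm9_smesp_of_thm37 (FSV2018_thm37_of_lemma36 h36),
    FSV2018_thm9_commROABP_of_cor44 (FSV2018_cor44_of_thm43 h43),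
    FSV2018_thm9_occur_of_cor49 h49,
    h6⟩

end Literature.Computability.AlgebraicComplexity

end
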